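import Summits.QuantumFields.BalabanUV.T4Continuum.Support.FirstOrderAdjointModel

/-!
# T⁴ programme, spine node NE2 (U1a), row B8 «general rate» PART 1, file 1 of 2 — TIER A AT A GENERAL RATE `θ ∈ [L⁻¹, 1)`: the scalar
# background structures with two-spacing consistency `β·θ^k` and the three tier-A `PerturbationLaws` (first order, adjoint, zeroth order)

NE2 formalisation swarm `b2b-balaban-t4-ne2-formalise-*`, leaf prover 07 (gen 3), HOLDER-LESS owner row B8 (CLAIMS.log 2026-08-20 owner ruling NE2
R17 (c): the STRUCTURE half of closer (M1′) of GAPS G-ne2leaf08g2-1 / referee c12; INTENT of this seat the same day).  APPEND-ONLY TWINS: no landed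
statement is edited; the instances of record (rate `L⁻¹`: `FirstOrderBackgroundModel.perturbationLaws_firstOrder`,
`FirstOrderAdjointModel.perturbationLaws_firstOrderAdjoint`, `PerturbationAlgebra.perturbationLaws_zerothOrder`) are neither touched nor superseded.
Companion file 2: `Support/CovariantLaplacianRate` (tier B: colour matrices, row B5's read-outs, node NE3 at rate `θ`, the part-1 ENDs).

WHY.  ROOT B consumes node NE3 through `hNE3 : LocalRate (bgReadings (regClass R)) C L⁻¹`, the rate `L⁻¹` being HARD-WIRED in the hypothesis
STRUCTURES of rows B2–B6 (two-spacing fields `consistent : ‖W (k+1) x′ − W k (parT x′)‖ ≤ β / L^k`), although the resolvent engine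
`BackgroundResolventTower.towerLimitRate_perturbed` takes any contraction rate `ρ < 1` (owner's ENGINE half `Spine/NE2ColourPerturbedLayerRate`).
Mismatch (M1) of G-ne2leaf08g2-1: a sup-currency supply from NE3's energy road would come at a rate `θ > L⁻¹` (`θ = L^{−2/3}` at `d = 4`).  THIS
FILE re-types tier A with the two-spacing consistency at rate `θ`, regularity (size, lattice-Lipschitz `β / L^k`) staying at the lattice scale:
 * §0 the one piece of arithmetic, `L^{−k} ≤ θ^k` for `L⁻¹ ≤ θ` (`invPow_le_pow`, `div_lev_le_mul_pow`, `div_lev_eq_mul_invPow`);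
 * §1 `LipschitzBackgroundRate V α β θ`, `BoundedBackgroundRate W α β θ` (`consistent : … ≤ β·θ^k`; hypothesis STRUCTURES on data), the `θ = L⁻¹`
   embeddings `lipschitzBackgroundRate_of_lev` / `boundedBackgroundRate_of_lev` (+ converses `…_of_rate_lev`), and the three tier-A laws RE-RUN through
   the landed TWO-LEVEL estimates, which already carry a FREE defect `δ` (`FirstOrderBackgroundModel.opNorm_consistency_le`,
   `FirstOrderAdjointModel.opNorm_adjoint_consistency_le`, the zeroth-order identity `diag W′·J − J·diag W = (diag W′ − diag(W∘parT))·J`):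
   **`perturbationLaws_firstOrder_rate`** (`κ = d(α+β)Cst`, `e₂ k = C2model·θ^k`), **`perturbationLaws_firstOrderAdjoint_rate`** (`C2adj·θ^k`),
   **`perturbationLaws_zerothOrder_rate`** (`Cst²β·θ^k`) — the SAME constants as at rate `L⁻¹` (with `δ = β·θ^k` the level factor `R = L` meets one
   sandwiched `F·J·∇𝒢` worth `Cst`, and the complement term `(2dCst/L^k)(L+1)αCst` is majorised by `·θ^k` since `L⁻¹ ≤ θ`).

HONEST FRAMING (T4-DAG p. 1).  Bookkeeping twins at MODEL LEVEL on OUR typed towers; constants OURS; no new estimate; nothing of node NE3; NE2 (U1a)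
NOT proved; ROOT B CONDITIONAL exactly as before (c1/c2/c3/c7); spine PROVED 0/9 unchanged; NOT infinite volume / mass gap / Clay.  HONEST DEPENDENCY:
continuum YM on T⁴ ⇐ BetaPertH ∧ nine spine estimates (0/9 proved); BetaPertH ⇐ (D1) ∧ (D4) ∧ CAP+tail; G-an2-4 gates asym, D1 and NE2/3/4.
ABSOLUTE RULE kept (nothing internally minted enters as a cited fact); hypothesis STRUCTURES on data only, no `def … : Prop` fact; no `sorry`.
-/

noncomputable section

open scoped BigOperators ComplexConjugate Matrix Matrix.Norms.L2Operator
open Filter Topology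

namespace Summit.QuantumFields.BalabanUV.T4Continuum.FirstOrderModelRate

open Literature.MathematicalPhysics.QuantumFieldTheory.Balaban1983to89.B5Prop11Plancherel
open Literature.MathematicalPhysics.QuantumFieldTheory.Balaban1983to89.B5G183RateUnitTower (lev lev_neZero)
open Summit.QuantumFields.BalabanUV.T4Continuum
open Summit.QuantumFields.BalabanUV.T4Continuum.BalabanAveragedTowerUnit (idx Qlev calGlev one_le_lev' cast_lev')
open Summit.QuantumFields.BalabanUV.T4Continuum.BackgroundResolventTower
open Summit.QuantumFields.BalabanUV.T4Continuum.KingPairingPlantedLaw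
open Summit.QuantumFields.BalabanUV.T4Continuum.BlockPairingGeometry
open Summit.QuantumFields.BalabanUV.T4Continuum.NE2PerturbedLayer
open Summit.QuantumFields.BalabanUV.T4Continuum.FirstOrderBackgroundModel
open Summit.QuantumFields.BalabanUV.T4Continuum.FirstOrderAdjointModel
open Summit.QuantumFields.BalabanUV.T4Continuum.PerturbationAlgebra

variable {d : ℕ}

/-! ## §0 The one piece of arithmetic: `L^{−k} ≤ θ^k` for `L⁻¹ ≤ θ` -/

section Arith

variable (L : ℕ)

/-- `L^{−k} ≤ θ^k` for `L⁻¹ ≤ θ`. [folklore] -/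
theorem invPow_le_pow {θ : ℝ} (hθ : ((L : ℝ)⁻¹) ≤ θ) (k : ℕ) : ((L : ℝ)⁻¹) ^ k ≤ θ ^ k :=
  pow_le_pow_left₀ (inv_nonneg.mpr (Nat.cast_nonneg L)) hθ k

/-- `0 ≤ θ` for `L⁻¹ ≤ θ`. [folklore] -/
theorem rate_nonneg {θ : ℝ} (hθ : ((L : ℝ)⁻¹) ≤ θ) : 0 ≤ θ := (inv_nonneg.mpr (Nat.cast_nonneg L)).trans hθ

/-- the lattice-scale currency is majorised by the rate-`θ` currency: `β / L^k ≤ β·θ^k` (`β ≥ 0`, `L⁻¹ ≤ θ`). [folklore] -/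
theorem div_lev_le_mul_pow {β θ : ℝ} (hβ : 0 ≤ β) (hθ : ((L : ℝ)⁻¹) ≤ θ) (k : ℕ) : β / (lev L k : ℕ) ≤ β * θ ^ k := by
  rw [cast_lev', div_eq_mul_inv, ← inv_pow]
  exact mul_le_mul_of_nonneg_left (invPow_le_pow L hθ k) hβ

/-- `β / L^k = β·(L⁻¹)^k`. [folklore] -/
theorem div_lev_eq_mul_invPow (β : ℝ) (k : ℕ) : β / (lev L k : ℕ) = β * ((L : ℝ)⁻¹) ^ k := by
  rw [cast_lev', div_eq_mul_inv, ← inv_pow]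

end Arith

/-! ## §1 Tier A at rate `θ`: the scalar structures and the three laws -/

section TierA

variable (L : ℕ) [NeZero L] (M : Fin d → ℕ) [hM : ∀ μ, NeZero (M μ)] (a : ℝ) (ha : 0 < a)

/-- **A LIPSCHITZ BACKGROUND SAMPLED AT EVERY SPACING, TWO-SPACING CONSISTENT AT RATE `θ`**: size `≤ α`, lattice-Lipschitz `β / L^k` at its own
spacing (regularity, UNCHANGED), and `|V^{(k+1)}(x′) − V^{(k)}(par x′)| ≤ β·θ^k` (the η-rate of the background — node NE3's currency — at a general
geometric rate).  A hypothesis structure on DATA; `FirstOrderBackgroundModel.LipschitzBackground` is the instance `θ = L⁻¹`. [folklore] -/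
structure LipschitzBackgroundRate (V : (k : ℕ) → Fin d → (idx L M k → ℂ)) (α β θ : ℝ) : Prop where
  /-- `α, β ≥ 0` -/
  nonneg : 0 ≤ α ∧ 0 ≤ β
  /-- size -/
  bound : ∀ k μ i, ‖V k μ i‖ ≤ α
  /-- Lipschitz at spacing `L^{−k}` -/
  lipschitz : ∀ k μ ν i, ‖V k μ (tau (fine (lev L k) M) ν i) - V k μ i‖ ≤ β / (lev L k : ℕ)
  /-- two-spacing consistency at the block parent, rate `θ` -/
  consistent : ∀ k μ (i : idx L M (k + 1)), ‖V (k + 1) μ i - V k μ (parT (lev L k) L M i)‖ ≤ β * θ ^ k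

/-- **A BOUNDED POTENTIAL SAMPLED AT EVERY SPACING, TWO-SPACING CONSISTENT AT RATE `θ`** (`PerturbationAlgebra.BoundedBackground` is `θ = L⁻¹`).
[folklore] -/
structure BoundedBackgroundRate (W : (k : ℕ) → (idx L M k → ℂ)) (α β θ : ℝ) : Prop where
  /-- `α, β ≥ 0` -/
  nonneg : 0 ≤ α ∧ 0 ≤ β
  /-- size -/
  bound : ∀ k i, ‖W k i‖ ≤ α
  /-- two-spacing consistency at the block parent, rate `θ` -/
  consistent : ∀ k (i : idx L M (k + 1)), ‖W (k + 1) i - W k (parT (lev L k) L M i)‖ ≤ β * θ ^ k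

variable {L M}

omit [NeZero L] hM in
/-- **THE INSTANCE OF RECORD IS THE SPECIAL CASE `θ = L⁻¹`**: `FirstOrderBackgroundModel.LipschitzBackground V α β` gives
`LipschitzBackgroundRate V α β L⁻¹` (`β / L^k = β·(L⁻¹)^k`). [folklore] -/
theorem lipschitzBackgroundRate_of_lev {V : (k : ℕ) → Fin d → (idx L M k → ℂ)} {α β : ℝ}
    (h : LipschitzBackground L M V α β) : LipschitzBackgroundRate L M V α β ((L : ℝ)⁻¹) where
  nonneg := h.nonneg
  bound := h.bound
  lipschitz := h.lipschitz
  consistent := fun k μ i => by rw [← div_lev_eq_mul_invPow L β k]; exact h.consistent k μ i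

omit [NeZero L] hM in
/-- and conversely: at `θ = L⁻¹` the rate structure IS the landed one (the two are the same hypothesis). [folklore] -/
theorem lipschitzBackground_of_rate_lev {V : (k : ℕ) → Fin d → (idx L M k → ℂ)} {α β : ℝ}
    (h : LipschitzBackgroundRate L M V α β ((L : ℝ)⁻¹)) : LipschitzBackground L M V α β where
  nonneg := h.nonneg
  bound := h.bound
  lipschitz := h.lipschitz
  consistent := fun k μ i => by rw [div_lev_eq_mul_invPow L β k]; exact h.consistent k μ i

omit [NeZero L] hM in
/-- **THE INSTANCE OF RECORD IS THE SPECIAL CASE `θ = L⁻¹`**, zeroth order: `PerturbationAlgebra.BoundedBackground W α β` gives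
`BoundedBackgroundRate W α β L⁻¹`. [folklore] -/
theorem boundedBackgroundRate_of_lev {W : (k : ℕ) → (idx L M k → ℂ)} {α β : ℝ} (h : BoundedBackground L M W α β) :
    BoundedBackgroundRate L M W α β ((L : ℝ)⁻¹) where
  nonneg := h.nonneg
  bound := h.bound
  consistent := fun k i => by rw [← div_lev_eq_mul_invPow L β k]; exact h.consistent k i

omit [NeZero L] hM in
/-- and conversely, zeroth order. [folklore] -/
theorem boundedBackground_of_rate_lev {W : (k : ℕ) → (idx L M k → ℂ)} {α β : ℝ} (h : BoundedBackgroundRate L M W α β ((L : ℝ)⁻¹)) :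
    BoundedBackground L M W α β where
  nonneg := h.nonneg
  bound := h.bound
  consistent := fun k i => by rw [div_lev_eq_mul_invPow L β k]; exact h.consistent k i

variable (L M)

/-- **`PerturbationLaws` FOR THE FIRST-ORDER MODEL AT RATE `θ`** (`d ≥ 1`, `L⁻¹ ≤ θ`): `κ = d(α + β)Cst`, `e₂ k = C2model·θ^k` — the SAME
constants as `FirstOrderBackgroundModel.perturbationLaws_firstOrder`; (H-cons) is the landed two-level estimate `opNorm_consistency_le` at the free
defect `δ = β·θ^k`, its complement term `(2dCst/L^k)(L+1)αCst` majorised by `·θ^k`. [folklore] -/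
theorem perturbationLaws_firstOrder_rate (hd : 1 ≤ d) {V : (k : ℕ) → Fin d → (idx L M k → ℂ)} {α β θ : ℝ}
    (hθ : ((L : ℝ)⁻¹) ≤ θ) (hV : LipschitzBackgroundRate L M V α β θ) :
    PerturbationLaws (calDalev L M a ha) (Pmodel L M V) (JpcT L M) (d * (α + β) * Cst d a)
      (fun k => C2model d L a α β * θ ^ k) where
  opNorm_P_mul_inv_le := fun k => by
    rw [calDalev_inv]
    have h := opNorm_firstOrder_mul_calG_le (lev L k) (one_le_lev' L k) M a ha hV.nonneg.1 (hV.bound k)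
    refine h.trans ?_
    exact mul_le_mul_of_nonneg_right (mul_le_mul_of_nonneg_left (le_add_of_nonneg_right hV.nonneg.2) (Nat.cast_nonneg d))
      (Cst_nonneg d a)
  opNorm_inv_mul_P_le := fun k => by
    rw [calDalev_inv]
    exact opNorm_calG_mul_firstOrder_le (lev L k) (one_le_lev' L k) M a ha hV.nonneg.1 hV.nonneg.2 (hV.bound k)
      (fun μ i => hV.lipschitz k μ μ i)
  consistent_le := fun k => by
    have hC := Cst_nonneg d a
    have hα := hV.nonneg.1
    have hθ0 := rate_nonneg L hθ
    have hδ : 0 ≤ β * θ ^ k := mul_nonneg hV.nonneg.2 (pow_nonneg hθ0 k)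
    rw [calDalev_inv, calDalev_inv]
    have h := opNorm_consistency_le (lev L k) L M a ha hd (one_le_lev' L k) (one_le_lev' L (k + 1)) hα hδ (hV.bound k)
      (hV.consistent k)
    refine h.trans ?_
    have hpow := invPow_le_pow L hθ k
    calc (d : ℝ) * (L * Cst d a * (β * θ ^ k) * Cst d a + 2 * d * Cst d a / (lev L k : ℕ) * (L + 1) * α * Cst d a)
        = d * (L * Cst d a * β * Cst d a) * θ ^ k
          + d * (2 * d * Cst d a * (L + 1) * α * Cst d a) * ((L : ℝ)⁻¹) ^ k := by
          rw [div_lev_eq_mul_invPow L]; ring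
      _ ≤ d * (L * Cst d a * β * Cst d a) * θ ^ k + d * (2 * d * Cst d a * (L + 1) * α * Cst d a) * θ ^ k := by
          have hY : (0 : ℝ) ≤ d * (2 * d * Cst d a * (L + 1) * α * Cst d a) := by positivity
          exact add_le_add le_rfl (mul_le_mul_of_nonneg_left hpow hY)
      _ = C2model d L a α β * θ ^ k := by rw [C2model]; ring

/-- **`PerturbationLaws` FOR THE ADJOINT FAMILY AT RATE `θ`** (`d ≥ 1`, `L⁻¹ ≤ θ`): `κ = d(α + β)Cst`, `e₂ k = C2adj·θ^k` (the landed
`opNorm_adjoint_consistency_le` at `δ = β·θ^k`). [folklore] -/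
theorem perturbationLaws_firstOrderAdjoint_rate (hd : 1 ≤ d) {V : (k : ℕ) → Fin d → (idx L M k → ℂ)} {α β θ : ℝ}
    (hθ : ((L : ℝ)⁻¹) ≤ θ) (hV : LipschitzBackgroundRate L M V α β θ) :
    PerturbationLaws (calDalev L M a ha) (fun k => (Pmodel L M V k)ᴴ) (JpcT L M) (d * (α + β) * Cst d a)
      (fun k => C2adj d L a α β * θ ^ k) where
  opNorm_P_mul_inv_le := fun k => by
    have e : (Pmodel L M V k)ᴴ * (calDalev L M a ha k)⁻¹ = ((calDalev L M a ha k)⁻¹ * Pmodel L M V k)ᴴ := by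
      rw [Matrix.conjTranspose_mul, conjTranspose_inv_calDalev]
    rw [e, Matrix.l2_opNorm_conjTranspose]
    exact (perturbationLaws_firstOrder_rate L M a ha hd hθ hV).opNorm_inv_mul_P_le k
  opNorm_inv_mul_P_le := fun k => by
    have e : (calDalev L M a ha k)⁻¹ * (Pmodel L M V k)ᴴ = (Pmodel L M V k * (calDalev L M a ha k)⁻¹)ᴴ := by
      rw [Matrix.conjTranspose_mul, conjTranspose_inv_calDalev]
    rw [e, Matrix.l2_opNorm_conjTranspose]
    exact (perturbationLaws_firstOrder_rate L M a ha hd hθ hV).opNorm_P_mul_inv_le k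
  consistent_le := fun k => by
    have hC := Cst_nonneg d a
    obtain ⟨hα, hβ⟩ := hV.nonneg
    have hθ0 := rate_nonneg L hθ
    have hδ : 0 ≤ β * θ ^ k := mul_nonneg hβ (pow_nonneg hθ0 k)
    change ‖(calDalev L M a ha (k + 1))⁻¹ * ((Pmodel L M V (k + 1))ᴴ * JpcT L M k - JpcT L M k * (Pmodel L M V k)ᴴ)
        * (calDalev L M a ha k)⁻¹‖ ≤ _
    rw [calDalev_inv, calDalev_inv]
    have h := opNorm_adjoint_consistency_le (lev L k) L M a ha hd (one_le_lev' L k) (one_le_lev' L (k + 1)) hα hβ hδ (hV.bound k)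
      (fun μ i => hV.lipschitz k μ μ i) (hV.consistent k)
    refine h.trans ?_
    have hpow := invPow_le_pow L hθ k
    calc (d : ℝ) * (Cst d a * (β * θ ^ k) * Cst d a + 2 * d * Cst d a / (lev L k : ℕ) * (L + 1) * ((α + β) * Cst d a))
        = d * (Cst d a * β * Cst d a) * θ ^ k
          + d * (2 * d * Cst d a * (L + 1) * ((α + β) * Cst d a)) * ((L : ℝ)⁻¹) ^ k := by
          rw [div_lev_eq_mul_invPow L]; ring
      _ ≤ d * (Cst d a * β * Cst d a) * θ ^ k + d * (2 * d * Cst d a * (L + 1) * ((α + β) * Cst d a)) * θ ^ k := by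
          have hY : (0 : ℝ) ≤ d * (2 * d * Cst d a * (L + 1) * ((α + β) * Cst d a)) := by positivity
          exact add_le_add le_rfl (mul_le_mul_of_nonneg_left hpow hY)
      _ = C2adj d L a α β * θ ^ k := by rw [C2adj]; ring

/-- **`PerturbationLaws` AT ZEROTH ORDER, RATE `θ`** (`0 ≤ θ`): `P_k = diag(W^{(k)})`, `κ = α·Cst`, `e₂ k = Cst²β·θ^k` (two-level identity
`diag W′·J − J·diag W = (diag W′ − diag(W∘parT))·J`; no `L^{−k}` term at all at zeroth order). [folklore] -/
theorem perturbationLaws_zerothOrder_rate {W : (k : ℕ) → (idx L M k → ℂ)} {α β θ : ℝ} (hθ0 : 0 ≤ θ)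
    (hW : BoundedBackgroundRate L M W α β θ) :
    PerturbationLaws (calDalev L M a ha) (fun k => Matrix.diagonal (W k)) (JpcT L M) (α * Cst d a)
      (fun k => Cst d a * β * Cst d a * θ ^ k) where
  opNorm_P_mul_inv_le := fun k =>
    (Matrix.l2_opNorm_mul _ _).trans (mul_le_mul (opNorm_diagonal_le _ hW.nonneg.1 (hW.bound k))
      (opNorm_inv_calDalev_le L M a ha k) (norm_nonneg _) hW.nonneg.1)
  opNorm_inv_mul_P_le := fun k => by
    rw [mul_comm α]
    exact (Matrix.l2_opNorm_mul _ _).trans (mul_le_mul (opNorm_inv_calDalev_le L M a ha k)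
      (opNorm_diagonal_le _ hW.nonneg.1 (hW.bound k)) (norm_nonneg _) (Cst_nonneg d a))
  consistent_le := fun k => by
    have hC := Cst_nonneg d a
    have hδ : 0 ≤ β * θ ^ k := mul_nonneg hW.nonneg.2 (pow_nonneg hθ0 k)
    have h' : JpcT L M k * Matrix.diagonal (W k)
        = Matrix.diagonal (fun i : idx L M (k + 1) => W k (parT (lev L k) L M i)) * JpcT L M k :=
      JK_mul_diagonal (lev L k) L M (W k)
    have e : Matrix.diagonal (W (k + 1)) * JpcT L M k - JpcT L M k * Matrix.diagonal (W k)
        = (Matrix.diagonal (W (k + 1)) - Matrix.diagonal (fun i : idx L M (k + 1) => W k (parT (lev L k) L M i))) * JpcT L M k := by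
      rw [Matrix.sub_mul, h']
    have hdiff : ‖Matrix.diagonal (W (k + 1)) - Matrix.diagonal (fun i : idx L M (k + 1) => W k (parT (lev L k) L M i))‖
        ≤ β * θ ^ k := by
      rw [Matrix.diagonal_sub]
      exact opNorm_diagonal_le _ hδ fun i => hW.consistent k i
    rw [e, ← Matrix.mul_assoc]
    calc _ ≤ ‖(calDalev L M a ha (k + 1))⁻¹ * (Matrix.diagonal (W (k + 1))
              - Matrix.diagonal (fun i : idx L M (k + 1) => W k (parT (lev L k) L M i))) * JpcT L M k‖
              * ‖(calDalev L M a ha k)⁻¹‖ := Matrix.l2_opNorm_mul _ _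
      _ ≤ ‖(calDalev L M a ha (k + 1))⁻¹ * (Matrix.diagonal (W (k + 1))
              - Matrix.diagonal (fun i : idx L M (k + 1) => W k (parT (lev L k) L M i)))‖
              * ‖JpcT L M k‖ * ‖(calDalev L M a ha k)⁻¹‖ :=
          mul_le_mul_of_nonneg_right (Matrix.l2_opNorm_mul _ _) (norm_nonneg _)
      _ ≤ (Cst d a * (β * θ ^ k)) * 1 * Cst d a := by
          have h0 : 0 ≤ Cst d a * (β * θ ^ k) := mul_nonneg hC hδ
          refine mul_le_mul (mul_le_mul ((Matrix.l2_opNorm_mul _ _).trans (mul_le_mul (opNorm_inv_calDalev_le L M a ha (k + 1))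
            hdiff (norm_nonneg _) hC)) (opNorm_JpcT_le L M k) (norm_nonneg _) h0) (opNorm_inv_calDalev_le L M a ha k)
            (norm_nonneg _) (mul_nonneg h0 zero_le_one)
      _ = Cst d a * β * Cst d a * θ ^ k := by ring

end TierA

end Summit.QuantumFields.BalabanUV.T4Continuum.FirstOrderModelRate

end
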